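import Mathlib
import Literature.NumberTheory.Transcendental.BakerLogarithmsConclusion
import Summits.Schanuel.Schanuel.Theses.RigidCore
import Summits.Schanuel.Schanuel.Theorems.RigidCoreTwoLogsBranchRelationFinite
import Literature.NumberTheory.Transcendental.LindemannWeierstrassProofs
import Summits.Schanuel.Schanuel.Theorems.RigidCoreSparsityTwoMixedPeriodPocketCore

/-!
# `stub_mixedPeriodPocket` (line `cusp-germ-schneider-sparsity` of crux `RigidCore.SparsityTwo`)

WHAT (item stmt-Schanuel-0971, POCKET "constant exponential coordinates"). For `l₀, l₁ ∈ ℂ` with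
`e^{l₀}, e^{l₁}` algebraic and NOT both roots of unity, and a non-zero `R ∈ ℚ[X, Y]`, only finitely
many lattice translates `x = (l₀ + 2πi j, l₁ + 2πi k)`, `(j, k) ∈ ℤ²`, are ℚ-linearly independent
zeros of `R`.

HOW.
* `(l₀, l₁, 2πi)` ℚ-independent: Theorem L verbatim (`TwoLogsBranchRelationFinite_proof`, item
  0975, PROVED) after the base change `ℚ → ℚ̄` of `R` (a non-zero constant `R` has no zeros).
* `(l₀, l₁, 2πi)` ℚ-dependent, `a l₀ + b l₁ + c · 2πi = 0` with `(a, b) ≠ 0`: complete the row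
  `(a, b)` to an invertible rational matrix with an INTEGER second row `(α, β) ∈ {(0,1), (1,0)}`. In
  the coordinates `X' = a X + b Y`, `Y' = α X + β Y` the lattice points become
  `(2πi · q₁, λ + 2πi · q₂)` with `q₁ = a j + b k - c`, `q₂ = α j + β k ∈ ℚ` and
  `λ = α l₀ + β l₁ = log ((e^{l₀})^α (e^{l₁})^β)`; a point with `q₁ = 0` is ℚ-DEPENDENT
  (`a x₁ + b x₂ = 0`). `λ ∉ ℚ · 2πi` (else both `e^{l₀}, e^{l₁}` are torsion), so `1, λ, 2πi` are
  `ℚ̄`-linearly independent by BAKER (`baker_holds`), and `2πi` is transcendental over `ℚ̄`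
  (Hermite–Lindemann `transcendental_exp_holds`, via
  `MixedPeriodPocket.transcendental_of_isAlgebraic_exp`). The core
  `MixedPeriod.finite_ratPoints` (file `RigidCoreSparsityTwoMixedPeriodPocketCore`: the functional /
  top-form argument of Theorem L with a descending induction in the divisible case) gives finitely
  many rational `(q₁, q₂)`, `q₁ ≠ 0`, on the transformed curve; the map `(j, k) ↦ (q₁, q₂)` is
  injective.
-/

-- `Summit.Schanuel.Schanuel` (summit = problem) trips core's duplicate-namespace linter.
set_option linter.dupNamespace false

namespace Summit.Schanuel.Schanuel.Cruxes.SparsityTwo.CuspGermSchneiderSparsity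

open Filter Topology Complex Polynomial Literature.NumberTheory.Transcendental
open scoped Real

open Summit.Schanuel.Schanuel.Theorems

/-- **Hermite–Lindemann over `ℚ̄`.** A nonzero complex number with algebraic exponential is
transcendental over the field `ℚ̄ ⊂ ℂ` of algebraic numbers (`transcendental_exp_holds`; the
`ℚ`-algebra structures on `ℚ̄` are realigned through `Subsingleton (Algebra ℚ _)`). -/
theorem MixedPeriodPocket.transcendental_of_isAlgebraic_exp {z : ℂ} (hz : z ≠ 0)
    (hexp : IsAlgebraic ℚ (Complex.exp z)) : Transcendental (algebraicClosure ℚ ℂ) z := by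
  intro halg
  haveI : Algebra.IsAlgebraic ℚ (algebraicClosure ℚ ℂ) := by
    have h := algebraicClosure.isAlgebraic ℚ ℂ
    have key : ∀ (i₁ i₂ : Algebra ℚ (algebraicClosure ℚ ℂ)), i₁ = i₂ →
        @Algebra.IsAlgebraic ℚ _ _ _ i₁ → @Algebra.IsAlgebraic ℚ _ _ _ i₂ := by
      rintro i₁ _ rfl h
      exact h
    exact key _ _ (Subsingleton.elim _ _) h
  have hQ : IsAlgebraic ℚ z := (isIntegral_trans (R := ℚ) _ halg.isIntegral).isAlgebraic
  exact transcendental_exp_holds hQ hz hexp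

/-- `e^{ρ · 2πi}` is a root of unity for rational `ρ`: its `ρ.den`-th power is `1`. -/
theorem MixedPeriodPocket.exp_rat_mul_pow_den (ρ : ℚ) :
    Complex.exp ((ρ : ℂ) * (2 * ↑π * I)) ^ ρ.den = 1 := by
  rw [← Complex.exp_nat_mul, ← mul_assoc]
  have h : ((ρ.den : ℕ) : ℂ) * (ρ : ℂ) = ((ρ.num : ℤ) : ℂ) := by
    have := Rat.den_mul_eq_num ρ
    exact_mod_cast this
  rw [h, Complex.exp_int_mul_two_pi_mul_I]

/-- The ℚ-INDEPENDENT case `(l₀, l₁, 2πi)`: Theorem L (`TwoLogsBranchRelationFinite_proof`) after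
the base change `ℚ → ℚ̄`; a non-zero constant `R` has no zeros at all. -/
theorem MixedPeriodPocket.indepCase (l₀ l₁ : ℂ) (h₀ : IsAlgebraic ℚ (Complex.exp l₀))
    (h₁ : IsAlgebraic ℚ (Complex.exp l₁)) (hli : LinearIndependent ℚ ![l₀, l₁, 2 * ↑π * I])
    (R : MvPolynomial (Fin 2) ℚ) (hR : R ≠ 0) :
    Set.Finite {p : ℤ × ℤ |
      MvPolynomial.aeval ![l₀ + 2 * ↑π * I * (p.1 : ℂ), l₁ + 2 * ↑π * I * (p.2 : ℂ)] R = 0} := by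
  set R' := MvPolynomial.map (algebraMap ℚ (algebraicClosure ℚ ℂ)) R with hR'
  have hinj : Function.Injective (algebraMap ℚ (algebraicClosure ℚ ℂ)) :=
    (algebraMap ℚ _).injective
  by_cases hdeg : 0 < R'.totalDegree
  · refine (TwoLogsBranchRelationFinite_proof l₀ l₁ h₀ h₁ hli R' hdeg).subset ?_
    intro p hp
    simp only [Set.mem_setOf_eq] at hp ⊢
    rw [hR', MvPolynomial.aeval_map_algebraMap]
    exact hp
  · have h0 : R'.totalDegree = 0 := by omega
    rw [MvPolynomial.totalDegree_eq_zero_iff_eq_C] at h0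
    have hc : MvPolynomial.coeff 0 R' ≠ 0 := by
      intro hc
      apply hR
      apply MvPolynomial.map_injective _ hinj
      rw [← hR', h0, hc, MvPolynomial.C_0, map_zero]
    refine Set.Finite.subset Set.finite_empty ?_
    intro p hp
    simp only [Set.mem_setOf_eq] at hp
    rw [← MvPolynomial.aeval_map_algebraMap (algebraicClosure ℚ ℂ), ← hR', h0,
      MvPolynomial.aeval_C] at hp
    exact (((map_ne_zero_iff _ (algebraMap (algebraicClosure ℚ ℂ) ℂ).injective).mpr hc) hp).elim

/-- The ℚ-DEPENDENT case: `a l₀ + b l₁ + c · 2πi = 0` over `ℚ`, with the row `(a, b)` completed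
by an integer row `(α, β)` to an invertible matrix. Unimodular-type change of coordinates, Baker
(`baker_holds`) for `λ = α l₀ + β l₁` and `2πi`, Hermite–Lindemann for `2πi`, and the core
`MixedPeriod.finite_ratPoints`. -/
theorem MixedPeriodPocket.depCase (l₀ l₁ : ℂ) (h₀ : IsAlgebraic ℚ (Complex.exp l₀))
    (h₁ : IsAlgebraic ℚ (Complex.exp l₁))
    (htor : ¬ ∃ q : ℕ, 0 < q ∧ Complex.exp l₀ ^ q = 1 ∧ Complex.exp l₁ ^ q = 1)
    (a b c : ℚ) (α β : ℤ) (hdet : a * β - b * α ≠ 0)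
    (hrel : (a : ℂ) * l₀ + (b : ℂ) * l₁ + (c : ℂ) * (2 * ↑π * I) = 0)
    (R : MvPolynomial (Fin 2) ℚ) (hR : R ≠ 0) :
    Set.Finite {p : ℤ × ℤ |
      LinearIndependent ℚ ![l₀ + 2 * ↑π * I * (p.1 : ℂ), l₁ + 2 * ↑π * I * (p.2 : ℂ)] ∧
      MvPolynomial.aeval ![l₀ + 2 * ↑π * I * (p.1 : ℂ), l₁ + 2 * ↑π * I * (p.2 : ℂ)] R = 0} := by
  obtain ⟨δ, hδ⟩ : ∃ δ : ℚ, δ = a * β - b * α := ⟨_, rfl⟩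
  have hδ0 : δ ≠ 0 := hδ ▸ hdet
  have hδC : (δ : ℂ) ≠ 0 := Rat.cast_ne_zero.mpr hδ0
  have hδ' : (δ : ℂ) = (a : ℂ) * (β : ℂ) - (b : ℂ) * (α : ℂ) := by rw [hδ]; push_cast; ring
  have hu : ((δ : ℂ))⁻¹ * ((a : ℂ) * (β : ℂ) - (b : ℂ) * (α : ℂ)) = 1 := by
    rw [← hδ', inv_mul_cancel₀ hδC]
  set t : ℂ := 2 * ↑π * I with ht_def
  have ht0 : t ≠ 0 := Complex.two_pi_I_ne_zero
  set lam : ℂ := (α : ℂ) * l₀ + (β : ℂ) * l₁ with hlam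
  -- (i) `lam, t` are ℚ-linearly independent (else both `e^{l₀}`, `e^{l₁}` are torsion)
  have hlamQ : LinearIndependent ℚ ![lam, t] := by
    rw [LinearIndependent.pair_iff]
    intro s r hsr
    have hsr' : (s : ℂ) * lam + (r : ℂ) * t = 0 := by simpa [Rat.smul_def] using hsr
    by_cases hs : s = 0
    · subst hs
      refine ⟨rfl, ?_⟩
      by_contra hr
      have : (r : ℂ) * t = 0 := by simpa using hsr'
      exact (mul_ne_zero (Rat.cast_ne_zero.mpr hr) ht0) this
    · exfalso
      have hsC : (s : ℂ) ≠ 0 := Rat.cast_ne_zero.mpr hs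
      set σ : ℚ := -(r / s) with hσ
      have hlamσ : (α : ℂ) * l₀ + (β : ℂ) * l₁ = (σ : ℂ) * t := by
        rw [← hlam, hσ]
        push_cast
        field_simp
        linear_combination hsr'
      set ρ₀ : ℚ := (-(β : ℚ) * c - b * σ) / δ with hρ₀
      set ρ₁ : ℚ := ((α : ℚ) * c + a * σ) / δ with hρ₁
      have hl₀ : l₀ = (ρ₀ : ℂ) * t := by
        have e : (δ : ℂ) * l₀ = ((-(β : ℚ) * c - b * σ : ℚ) : ℂ) * t := by
          rw [hδ']
          push_cast
          linear_combination (β : ℂ) * hrel - (b : ℂ) * hlamσ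
        rw [hρ₀, Rat.cast_div, div_mul_eq_mul_div, eq_div_iff hδC, mul_comm, e]
      have hl₁ : l₁ = (ρ₁ : ℂ) * t := by
        have e : (δ : ℂ) * l₁ = (((α : ℚ) * c + a * σ : ℚ) : ℂ) * t := by
          rw [hδ']
          push_cast
          linear_combination (a : ℂ) * hlamσ - (α : ℂ) * hrel
        rw [hρ₁, Rat.cast_div, div_mul_eq_mul_div, eq_div_iff hδC, mul_comm, e]
      apply htor
      refine ⟨ρ₀.den * ρ₁.den, Nat.mul_pos ρ₀.den_pos ρ₁.den_pos, ?_, ?_⟩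
      · rw [hl₀, ht_def, pow_mul, MixedPeriodPocket.exp_rat_mul_pow_den, one_pow]
      · rw [hl₁, ht_def, mul_comm ρ₀.den, pow_mul, MixedPeriodPocket.exp_rat_mul_pow_den, one_pow]
  -- (ii) Baker: `1, lam, t` are `ℚ̄`-linearly independent; Hermite–Lindemann: `t` is transcendental
  have hexp_lam : IsAlgebraic ℚ (Complex.exp lam) := by
    have e : Complex.exp lam = Complex.exp l₀ ^ α * Complex.exp l₁ ^ β := by
      rw [hlam, Complex.exp_add, Complex.exp_int_mul, Complex.exp_int_mul]
    rw [e]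
    exact mem_algebraicClosure_iff.mp (mul_mem (zpow_mem (mem_algebraicClosure_iff.mpr h₀) α)
      (zpow_mem (mem_algebraicClosure_iff.mpr h₁) β))
  have halg : ∀ i, IsAlgebraic ℚ (Complex.exp ((![lam, t] : Fin 2 → ℂ) i)) := by
    intro i
    fin_cases i
    · simpa using hexp_lam
    · simp [ht_def, Complex.exp_two_pi_mul_I, isAlgebraic_one]
  have hB := baker_holds (![lam, t] : Fin 2 → ℂ) halg hlamQ
  have hli3 : LinearIndependent (algebraicClosure ℚ ℂ) ![(1 : ℂ), lam, t] := by
    let e : Fin 3 → Option (Fin 2) := ![none, some 0, some 1]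
    have he : Function.Injective e := by
      intro i j hij
      fin_cases i <;> fin_cases j <;> simp_all [e]
    have := hB.comp e he
    convert this using 1
    funext i
    fin_cases i <;> rfl
  have htr : Transcendental (algebraicClosure ℚ ℂ) t :=
    MixedPeriodPocket.transcendental_of_isAlgebraic_exp ht0
      (by rw [ht_def, Complex.exp_two_pi_mul_I]; exact isAlgebraic_one)
  -- (iii) the inverse coordinate change `X = (β X' - b Y')/δ`, `Y = (-α X' + a Y')/δ`
  set sub : Fin 2 → MvPolynomial (Fin 2) ℚ :=
    ![MvPolynomial.C δ⁻¹ *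
        (MvPolynomial.C (β : ℚ) * MvPolynomial.X 0 - MvPolynomial.C b * MvPolynomial.X 1),
      MvPolynomial.C δ⁻¹ *
        (MvPolynomial.C a * MvPolynomial.X 1 - MvPolynomial.C (α : ℚ) * MvPolynomial.X 0)]
    with hsub
  set Rt : MvPolynomial (Fin 2) ℚ := MvPolynomial.bind₁ sub R with hRt
  have hRt0 : Rt ≠ 0 := by
    have huQ : δ⁻¹ * (a * β - b * α) = 1 := by rw [← hδ, inv_mul_cancel₀ hδ0]
    have key : MvPolynomial.C δ⁻¹ * (MvPolynomial.C a * MvPolynomial.C (β : ℚ)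
        - MvPolynomial.C b * MvPolynomial.C (α : ℚ)) = (1 : MvPolynomial (Fin 2) ℚ) := by
      rw [← map_mul, ← map_mul, ← map_sub, ← map_mul, huQ, MvPolynomial.C_1]
    set sub' : Fin 2 → MvPolynomial (Fin 2) ℚ :=
      ![MvPolynomial.C a * MvPolynomial.X 0 + MvPolynomial.C b * MvPolynomial.X 1,
        MvPolynomial.C (α : ℚ) * MvPolynomial.X 0 + MvPolynomial.C (β : ℚ) * MvPolynomial.X 1]
      with hsub'
    have hcomp : (fun i => MvPolynomial.bind₁ sub' (sub i)) = MvPolynomial.X := by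
      funext i
      fin_cases i
      · simp only [hsub, hsub', Fin.zero_eta, Matrix.cons_val_zero, Matrix.cons_val_one,
          Matrix.cons_val_fin_one, map_sub, map_mul, MvPolynomial.bind₁_C_right,
          MvPolynomial.bind₁_X_right]
        linear_combination (MvPolynomial.X 0 : MvPolynomial (Fin 2) ℚ) * key
      · simp only [hsub, hsub', Fin.mk_one, Matrix.cons_val_zero, Matrix.cons_val_one,
          Matrix.cons_val_fin_one, map_sub, map_mul, MvPolynomial.bind₁_C_right,
          MvPolynomial.bind₁_X_right]
        linear_combination (MvPolynomial.X 1 : MvPolynomial (Fin 2) ℚ) * key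
    have hinv : MvPolynomial.bind₁ sub' Rt = R := by
      rw [hRt, MvPolynomial.bind₁_bind₁, hcomp, MvPolynomial.bind₁_X_left, AlgHom.id_apply]
    intro h
    apply hR
    rw [← hinv, h, map_zero]
  set R' := MvPolynomial.map (algebraMap ℚ (algebraicClosure ℚ ℂ)) Rt with hR'
  have hR'0 : R' ≠ 0 := by
    intro h
    apply hRt0
    apply MvPolynomial.map_injective _ (algebraMap ℚ (algebraicClosure ℚ ℂ)).injective
    rw [← hR', h, map_zero]
  -- (iv) the core finiteness on the transformed curve, pulled back along the injective lattice map
  have hfin := MixedPeriod.finite_ratPoints lam t htr hli3 R' hR'0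
  let F : ℤ × ℤ → ℚ × ℚ := fun p => (a * p.1 + b * p.2 - c, (α : ℚ) * p.1 + (β : ℚ) * p.2)
  have hF : Function.Injective F := by
    intro p p' h
    simp only [F, Prod.mk.injEq] at h
    obtain ⟨h1, h2⟩ := h
    have e1 : ((p.1 : ℚ) - p'.1) * δ = 0 := by
      rw [hδ]; linear_combination (β : ℚ) * h1 - b * h2
    have e2 : ((p.2 : ℚ) - p'.2) * δ = 0 := by
      rw [hδ]; linear_combination a * h2 - (α : ℚ) * h1
    rcases mul_eq_zero.mp e1 with e1 | e1
    · rcases mul_eq_zero.mp e2 with e2 | e2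
      · exact Prod.ext (by exact_mod_cast sub_eq_zero.mp e1) (by exact_mod_cast sub_eq_zero.mp e2)
      · exact absurd e2 hδ0
    · exact absurd e1 hδ0
  refine (hfin.preimage hF.injOn).subset ?_
  rintro p ⟨hind, hz⟩
  simp only [Set.mem_preimage, Set.mem_setOf_eq, F]
  have hX : (a : ℂ) * (l₀ + t * (p.1 : ℂ)) + (b : ℂ) * (l₁ + t * (p.2 : ℂ)) =
      t * ((a * p.1 + b * p.2 - c : ℚ) : ℂ) := by
    push_cast
    linear_combination hrel
  constructor
  · intro h0
    have hdep := LinearIndependent.pair_iff.mp hind a b (by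
      rw [Rat.smul_def, Rat.smul_def, hX, h0, Rat.cast_zero, mul_zero])
    apply hδ0
    rw [hδ, hdep.1, hdep.2]
    ring
  · rw [hR', MvPolynomial.aeval_map_algebraMap, hRt, MvPolynomial.aeval_bind₁]
    have hpt : (fun i => MvPolynomial.aeval
        (![t * ((a * p.1 + b * p.2 - c : ℚ) : ℂ),
          lam + t * (((α : ℚ) * p.1 + (β : ℚ) * p.2 : ℚ) : ℂ)] : Fin 2 → ℂ) (sub i)) =
        ![l₀ + t * (p.1 : ℂ), l₁ + t * (p.2 : ℂ)] := by
      funext i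
      fin_cases i
      · simp only [hsub, Fin.zero_eta, Matrix.cons_val_zero, map_sub, map_mul,
          MvPolynomial.aeval_C, MvPolynomial.aeval_X, Matrix.cons_val_one, Matrix.cons_val_fin_one,
          eq_ratCast]
        push_cast
        linear_combination (-((δ : ℂ))⁻¹ * (β : ℂ)) * hrel + (-((δ : ℂ))⁻¹ * (b : ℂ)) * hlam
          + (t * (p.1 : ℂ) + l₀) * hu
      · simp only [hsub, Fin.mk_one, Matrix.cons_val_zero, map_sub, map_mul,
          MvPolynomial.aeval_C, MvPolynomial.aeval_X, Matrix.cons_val_one, Matrix.cons_val_fin_one,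
          eq_ratCast]
        push_cast
        linear_combination (((δ : ℂ))⁻¹ * (α : ℂ)) * hrel + (((δ : ℂ))⁻¹ * (a : ℂ)) * hlam
          + (t * (p.2 : ℂ) + l₁) * hu
    rw [hpt]
    exact hz

/-- **stub_mixedPeriodPocket** (POCKET "constant exponential coordinates"). For `l₀, l₁ ∈ ℂ` with
`e^{l₀}, e^{l₁}` algebraic and NOT both roots of unity, and a non-zero `R ∈ ℚ[X, Y]`, only finitely
many lattice translates `x = (l₀ + 2πi j, l₁ + 2πi k)`, `(j, k) ∈ ℤ²`, are ℚ-linearly independent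
zeros of `R`. ℚ-independent `(l₀, l₁, 2πi)`: Theorem L (`TwoLogsBranchRelationFinite_proof`);
ℚ-dependent: `MixedPeriodPocket.depCase` (Baker + Hermite–Lindemann + the functional / top-form
argument `MixedPeriod.finite_ratPoints`). -/
theorem stub_mixedPeriodPocket :
    ∀ (l₀ l₁ : ℂ), IsAlgebraic ℚ (Complex.exp l₀) → IsAlgebraic ℚ (Complex.exp l₁) →
      (¬ ∃ q : ℕ, 0 < q ∧ Complex.exp l₀ ^ q = 1 ∧ Complex.exp l₁ ^ q = 1) →
      ∀ R : MvPolynomial (Fin 2) ℚ, R ≠ 0 →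
        Set.Finite {p : ℤ × ℤ |
          LinearIndependent ℚ ![l₀ + 2 * ↑π * I * (p.1 : ℂ), l₁ + 2 * ↑π * I * (p.2 : ℂ)] ∧
          MvPolynomial.aeval ![l₀ + 2 * ↑π * I * (p.1 : ℂ), l₁ + 2 * ↑π * I * (p.2 : ℂ)] R = 0} := by
  intro l₀ l₁ h₀ h₁ htor R hR
  by_cases hli : LinearIndependent ℚ ![l₀, l₁, 2 * ↑π * I]
  · exact (MixedPeriodPocket.indepCase l₀ l₁ h₀ h₁ hli R hR).subset fun p hp => hp.2
  · rw [Fintype.not_linearIndependent_iff] at hli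
    obtain ⟨g, hg, i, hi⟩ := hli
    rw [Fin.sum_univ_three] at hg
    simp only [Matrix.cons_val_zero, Matrix.cons_val_one, Matrix.cons_val_two, Matrix.head_cons,
      Matrix.tail_cons, Rat.smul_def] at hg
    by_cases ha : g 0 = 0
    · by_cases hb : g 1 = 0
      · exfalso
        have h2 : g 2 ≠ 0 := by
          fin_cases i
          · exact absurd ha hi
          · exact absurd hb hi
          · exact hi
        rw [ha, hb, Rat.cast_zero, zero_mul, zero_mul, zero_add, zero_add] at hg
        exact (mul_ne_zero (Rat.cast_ne_zero.mpr h2) Complex.two_pi_I_ne_zero) hg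
      · exact MixedPeriodPocket.depCase l₀ l₁ h₀ h₁ htor (g 0) (g 1) (g 2) 1 0
          (by simpa [ha] using hb) hg R hR
    · exact MixedPeriodPocket.depCase l₀ l₁ h₀ h₁ htor (g 0) (g 1) (g 2) 0 1 (by simpa using ha)
        hg R hR

end Summit.Schanuel.Schanuel.Cruxes.SparsityTwo.CuspGermSchneiderSparsity
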